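import Literature.MathematicalPhysics.QuantumFieldTheory.Balaban1983to89.T3AveragedTailProfile
import HarnessLib

/-!
# `FluctuationComparisonRegPrIntLSupTailModulus` — LINE g21-1 «SUP-TAIL × CRUDE LOCALITY»: THE MODULUS OF TAILSUP IS BOOKKEEPING
# (crux `UnitScaleTilt.FluctuationComparisonRegPrIntL`, stmt-QuantumFields-20520; row TAILSUP `WindowOddsSupCan` of `Cruxes/…/Lines/suptail_split.lean` v1, ideator ym-r3-idea-1 g21)

Cell `ym3-torus` (YM ladder rung R3 = continuum SU(2) Yang–Mills on T³ — a RUNG, NOT the Clay problem: not d = 4, not infinite volume, not a mass gap);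
width seat `ym-ust-20520-w3` (gen 17); helper `--supports stmt-QuantumFields-20520`.  THEOREMS ONLY (0 `def`, 0 `sorry`, default heartbeats).  Companion of
`…SupTailReduction` (TAILSUP ⟸ COND-ODDS, the setwise conditional-odds inequality `Gibbs_K(D⁻¹B) ≤ e^{τ J}·Gibbs_K(D⁻¹B ∩ histGood K J)` on the window); this file
supplies the three arithmetic facts that turn a hand's union bound in print's currency into COND-ODDS's constant and TAILSUP's modulus clause:
* `measure_le_exp_mul_inter_of_badFraction` — a bad fraction `μ(A ∖ G) ≤ x·μ(A)` with `x ≤ 1∕2` gives `μ(A) ≤ e^{2x}·μ(A ∩ G)` (`e^{−2x} ≤ 1 − x`): COND-ODDS's shape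
  with `τ = 2x` from `P(bad history ∣ window σ-algebra) ≤ x`;
* ★`sum_perHeight_le_geometric` — print's PER-PLAQUETTE large-field currency `#Plaq_j·C·β_j^A·e^{−c·p(g_j)²}` ([Balaban1985UV3] (71)) summed over the free levels
  `J < j < N` is `≤ A'·(1∕2)^J`, uniformly in `N` (lit ✓`T3AveragedTailProfile.perHeight_bound`, «Gaussian beats exponential», `0 < γ ≤ 1`, `p₀ ≥ 1`);
* `tendsto_pow_mul_geometric`, `superpoly_of_le_geometric` — `(J+1)^a·τ J → 0` for every `a` whenever `0 ≤ τ J ≤ A'·(1∕2)^J`: TAILSUP's clause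
  `∀ a, (J+1)^a·τ J → 0` costs nothing beyond the Gaussian-tail × entropy shape.
HONEST SCOPE.  Arithmetic; nothing of TAILSUP's large-deviation content is proved; TAILSUP, LFR♯ᶜ, S2β, 20520, `YM3TorusSU2` NOT proved; the Yang–Mills mass gap is NOT proved.
References: [Balaban1985UV3] (7) p. 257 and (71) p. 273.
-/

noncomputable section

set_option autoImplicit false

open MeasureTheory Filter Topology Set
open scoped ENNReal NNReal BigOperators
open Literature.MathematicalPhysics.QuantumFieldTheory.Balaban1983to89
open Literature.MathematicalPhysics.QuantumFieldTheory.Balaban1983to89.T3ContinuumYM3Torus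
open Literature.MathematicalPhysics.QuantumFieldTheory.Balaban1983to89.T3UnitLawDensityEML

namespace Summit.QuantumFields.YangMills.Theorems.FluctuationComparisonRegPrIntLSupTailModulus

/-! ## §1 Bad fraction ⇒ COND-ODDS's shape; §2 per-plaquette currency ⇒ `A'·2^{−J}`; §3 super-polynomial smallness -/

/-- **A BAD FRACTION `x ≤ 1∕2` GIVES COND-ODDS's SHAPE WITH `τ = 2x`**: for a finite measure and sets `A` (think `D⁻¹B`) and `G` (think `histGood`), if
`μ(A \ G) ≤ x·μ(A)` with `0 ≤ x ≤ 1∕2` then `μ(A) ≤ e^{2x}·μ(A ∩ G)`.  This is how a hand's union bound `P(bad ∣ window σ-algebra) ≤ x_J` becomes the door's hypothesis.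
[folklore] -/
theorem measure_le_exp_mul_inter_of_badFraction {X : Type*} [MeasurableSpace X] (μ : Measure X) [IsFiniteMeasure μ] {A G : Set X}
    (hG : MeasurableSet G) {x : ℝ} (hx0 : 0 ≤ x) (hx : x ≤ 1 / 2) (hbad : μ (A \ G) ≤ ENNReal.ofReal x * μ A) :
    μ A ≤ ENNReal.ofReal (Real.exp (2 * x)) * μ (A ∩ G) := by
  -- pass to real numbers
  have hA : μ A = μ (A ∩ G) + μ (A \ G) := (measure_inter_add_sdiff A hG).symm
  have hfinA : μ A ≠ ∞ := measure_ne_top μ A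
  have hfinG : μ (A ∩ G) ≠ ∞ := measure_ne_top μ _
  have hfinD : μ (A \ G) ≠ ∞ := measure_ne_top μ _
  have hAr : μ.real A = μ.real (A ∩ G) + μ.real (A \ G) := by
    rw [measureReal_def, measureReal_def, measureReal_def, hA, ENNReal.toReal_add hfinG hfinD]
  have hbadr : μ.real (A \ G) ≤ x * μ.real A := by
    have := ENNReal.toReal_mono (ENNReal.mul_ne_top ENNReal.ofReal_ne_top hfinA) hbad
    rwa [ENNReal.toReal_mul, ENNReal.toReal_ofReal hx0] at this
  have hkey : (1 - x) * μ.real A ≤ μ.real (A ∩ G) := by nlinarith [hAr, hbadr]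
  -- `e^{−2x} ≤ 1 − x` for `0 ≤ x ≤ 1/2` (from `1 + y ≤ e^{y}`: `e^{−2x} ≤ (1 + 2x)⁻¹ ≤ 1 − x`; folklore, inlined — the tree keeps copies
  -- of this one-liner private in unrelated Literature files)
  have hel : Real.exp (-(2 * x)) ≤ 1 - x := by
    have h1 : 1 + 2 * x ≤ Real.exp (2 * x) := by
      have := Real.add_one_le_exp (2 * x)
      linarith
    have hpos : 0 < 1 + 2 * x := by linarith
    rw [Real.exp_neg]
    calc (Real.exp (2 * x))⁻¹ ≤ (1 + 2 * x)⁻¹ := inv_anti₀ hpos h1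
      _ ≤ 1 - x := by
          rw [inv_le_iff_one_le_mul₀ hpos]
          nlinarith
  have hexp : Real.exp (-(2 * x)) * μ.real A ≤ μ.real (A ∩ G) :=
    le_trans (mul_le_mul_of_nonneg_right hel measureReal_nonneg) hkey
  have hreal : μ.real A ≤ Real.exp (2 * x) * μ.real (A ∩ G) := by
    have := mul_le_mul_of_nonneg_left hexp (Real.exp_pos (2 * x)).le
    rwa [← mul_assoc, ← Real.exp_add, add_neg_cancel, Real.exp_zero, one_mul] at this
  calc μ A = ENNReal.ofReal (μ.real A) := (ENNReal.ofReal_toReal hfinA).symm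
    _ ≤ ENNReal.ofReal (Real.exp (2 * x) * μ.real (A ∩ G)) := ENNReal.ofReal_le_ofReal hreal
    _ = ENNReal.ofReal (Real.exp (2 * x)) * μ (A ∩ G) := by
        rw [ENNReal.ofReal_mul (Real.exp_pos _).le, measureReal_def, ENNReal.ofReal_toReal hfinG]

/-- ★ **PRINT's PER-PLAQUETTE CURRENCY, SUMMED OVER THE FREE LEVELS `j > J`, IS `≤ A'·2^{−J}`** (`0 < γ ≤ 1`, `0 < b₀`, `1 ≤ p₀`, `C ≥ 0`, `c > 0`): with the
per-height count `9·(8L^{3m}(L^j)³)` of plaquettes and the per-plaquette large-field factor `C·β_j^A·e^{−c·p(g_j)²}` (`β_j = (γL^{−j})⁻¹`, `g_j = √(γL^{−j})`,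
`p = B10.pFun b₀ p₀`; [Balaban1985UV3] (71)), every partial sum over `J < j < N` is at most `A'·(1∕2)^J` with the explicit `A'` of lit ✓`T3AveragedTailProfile.perHeight_bound`
(«Gaussian beats exponential»). [cite: Balaban1985UV3, (7) p.257 and (71) p.273] -/
theorem sum_perHeight_le_geometric (F : T3Family) {γ b₀ p₀ : ℝ} (hγ : 0 < γ) (hγ1 : γ ≤ 1) (hb₀ : 0 < b₀) (hp₀ : 1 ≤ p₀)
    {C : ℝ} (hC : 0 ≤ C) (A : ℕ) {c : ℝ} (hc : 0 < c) (J N : ℕ) :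
    ∑ j ∈ Finset.Ico (J + 1) N,
        (9 * (8 * (F.L : ℝ) ^ (3 * F.m) * ((F.L : ℝ) ^ j) ^ 3)) *
          (C * (F.scheme ℰp γ).β j ^ A * Real.exp (-(c * B10.pFun b₀ p₀ (Real.sqrt (γ * ((F.L : ℝ)⁻¹) ^ j)) ^ 2))) ≤
      (72 * C * (F.L : ℝ) ^ (3 * F.m) * γ⁻¹ ^ A *
          Real.exp ((((3 : ℝ) + A) * Real.log F.L + Real.log 2) ^ 2 / (4 * (c * b₀ ^ 2 * Real.log F.L ^ 2 / 4)))) *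
        ((1 : ℝ) / 2) ^ J := by
  set A' : ℝ := 72 * C * (F.L : ℝ) ^ (3 * F.m) * γ⁻¹ ^ A *
      Real.exp ((((3 : ℝ) + A) * Real.log F.L + Real.log 2) ^ 2 / (4 * (c * b₀ ^ 2 * Real.log F.L ^ 2 / 4))) with hA'
  have hA'0 : 0 ≤ A' := by
    have hL0 : (0 : ℝ) ≤ F.L := Nat.cast_nonneg _
    positivity
  calc ∑ j ∈ Finset.Ico (J + 1) N,
        (9 * (8 * (F.L : ℝ) ^ (3 * F.m) * ((F.L : ℝ) ^ j) ^ 3)) *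
          (C * (F.scheme ℰp γ).β j ^ A * Real.exp (-(c * B10.pFun b₀ p₀ (Real.sqrt (γ * ((F.L : ℝ)⁻¹) ^ j)) ^ 2)))
      ≤ ∑ j ∈ Finset.Ico (J + 1) N, A' * ((1 : ℝ) / 2) ^ j :=
        Finset.sum_le_sum fun j _ => T3AveragedTailProfile.perHeight_bound F hγ hγ1 hb₀ hp₀ hC A hc j
    _ = A' * ∑ j ∈ Finset.Ico (J + 1) N, ((1 : ℝ) / 2) ^ j := (Finset.mul_sum _ _ _).symm
    _ ≤ A' * ((1 : ℝ) / 2) ^ J := by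
        refine mul_le_mul_of_nonneg_left ?_ hA'0
        have hgeom : ∑ j ∈ Finset.Ico (J + 1) N, ((1 : ℝ) / 2) ^ j ≤ ∑' j : ℕ, Set.indicator {j | J + 1 ≤ j} (fun j => ((1 : ℝ) / 2) ^ j) j := by
          have hsum : Summable (Set.indicator {j : ℕ | J + 1 ≤ j} (fun j => ((1 : ℝ) / 2) ^ j)) :=
            (summable_geometric_of_lt_one (by norm_num) (by norm_num)).indicator _
          calc ∑ j ∈ Finset.Ico (J + 1) N, ((1 : ℝ) / 2) ^ j
              = ∑ j ∈ Finset.Ico (J + 1) N, Set.indicator {j | J + 1 ≤ j} (fun j => ((1 : ℝ) / 2) ^ j) j := by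
                refine Finset.sum_congr rfl fun j hj => ?_
                rw [Set.indicator_of_mem]
                exact (Finset.mem_Ico.mp hj).1
            _ ≤ ∑' j : ℕ, Set.indicator {j | J + 1 ≤ j} (fun j => ((1 : ℝ) / 2) ^ j) j :=
                hsum.sum_le_tsum _ fun j _ => Set.indicator_nonneg (fun _ _ => by positivity) _
        have htail : ∑' j : ℕ, Set.indicator {j | J + 1 ≤ j} (fun j => ((1 : ℝ) / 2) ^ j) j = ((1 : ℝ) / 2) ^ J := by
          have h1 : ∑' j : ℕ, Set.indicator {j | J + 1 ≤ j} (fun j => ((1 : ℝ) / 2) ^ j) j = ∑' j : ℕ, ((1 : ℝ) / 2) ^ (j + (J + 1)) := by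
            rw [← _root_.tsum_subtype {j : ℕ | J + 1 ≤ j} (fun j => ((1 : ℝ) / 2) ^ j)]
            have : {j : ℕ | J + 1 ≤ j} = Set.range (fun j : ℕ => j + (J + 1)) := by
              ext j
              simp only [Set.mem_setOf_eq, Set.mem_range]
              constructor
              · intro hj; exact ⟨j - (J + 1), by omega⟩
              · rintro ⟨i, rfl⟩; omega
            rw [this, _root_.tsum_range (fun j => ((1 : ℝ) / 2) ^ j) (fun a b hab => by simpa using hab)]
          rw [h1]
          simp_rw [pow_add]
          rw [_root_.tsum_mul_right, tsum_geometric_of_lt_one (by norm_num) (by norm_num)]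
          rw [pow_succ]
          norm_num
          ring
        exact hgeom.trans htail.le

/-- **SUPER-POLYNOMIAL SMALLNESS OF A GEOMETRIC MODULUS**: `(J+1)^a · (A'·2^{−J}) → 0` for every `a : ℕ` — TAILSUP's modulus clause for any `τ J ≤ A'·(1∕2)^J`.
[folklore] -/
theorem tendsto_pow_mul_geometric (a : ℕ) (A' : ℝ) :
    Tendsto (fun J : ℕ => ((J : ℝ) + 1) ^ a * (A' * ((1 : ℝ) / 2) ^ J)) atTop (𝓝 0) := by
  have h := tendsto_pow_const_mul_const_pow_of_abs_lt_one a (r := (1 : ℝ) / 2) (by rw [abs_of_pos (by norm_num)]; norm_num)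
  -- shift by one: `(J+1)^a (1/2)^(J+1)` → 0, and `(1/2)^J = 2·(1/2)^(J+1)`
  have h1 : Tendsto (fun J : ℕ => (((J + 1 : ℕ) : ℝ)) ^ a * ((1 : ℝ) / 2) ^ (J + 1)) atTop (𝓝 0) :=
    h.comp (tendsto_add_atTop_nat 1)
  have h2 : Tendsto (fun J : ℕ => (2 * A') * ((((J + 1 : ℕ) : ℝ)) ^ a * ((1 : ℝ) / 2) ^ (J + 1))) atTop (𝓝 0) := by
    simpa using h1.const_mul (2 * A')
  refine h2.congr fun J => ?_
  push_cast
  ring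

/-- **TAILSUP's MODULUS CLAUSE FROM A GEOMETRIC MAJORANT**: if `0 ≤ τ J ≤ A'·(1∕2)^J` for all `J` then `(J+1)^a·τ J → 0` for every `a`. [folklore] -/
theorem superpoly_of_le_geometric {τ : ℕ → ℝ} {A' : ℝ} (h0 : ∀ J, 0 ≤ τ J) (hle : ∀ J, τ J ≤ A' * ((1 : ℝ) / 2) ^ J) (a : ℕ) :
    Tendsto (fun J : ℕ => ((J : ℝ) + 1) ^ a * τ J) atTop (𝓝 0) := by
  refine squeeze_zero (fun J => mul_nonneg (by positivity) (h0 J)) (fun J => ?_) (tendsto_pow_mul_geometric a A')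
  exact mul_le_mul_of_nonneg_left (hle J) (by positivity)

end Summit.QuantumFields.YangMills.Theorems.FluctuationComparisonRegPrIntLSupTailModulus

end
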